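import Mathlib

/-!
# Quadratic spectral-mapping resolvent kernel (solo-blind programme, kernel #172)

Pure algebra behind the `two-constants certificate' (B12) for the resonance factor of a
periodic monodromy `M`: with `t = tr M` (or any element commuting with `M`) the quadratic
`p(z) = z (z - t)` satisfies the factorisations

`(1 - M) * (1 + M - t) = (1 - t) - (M * M - t * M) = (1 + M - t) * (1 - M)`,

so a two-sided inverse `e` of `E := (1 - t) - (M * M - t * M)` (available as soon as
`‖M * M - t * M‖ < |1 - t|`) yields the two-sided inverse `(1 + M - t) * e = e * (1 + M - t)`
of `1 - M`; in a normed ring this gives `‖(1 - M)⁻¹‖ ≤ (1 + ‖M‖ + ‖t‖) ‖e‖`.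
The eigenvector form of the spectral mapping (`M v = μ v ⇒ (M² - tM) v = μ(μ - t) v`) is
recorded for matrices.  No analysis is used here.
-/

namespace Summit.AnomalousDissipation.AnomalousDissipation.Theorems

section ring

variable {R : Type*} [Ring R]

/-- `(1 - M)(1 + M - T) = (1 - T) - (M² - TM)` when `T` commutes with `M`. -/
theorem soloBlind_quad_factor_left (M T : R) (hT : T * M = M * T) :
    (1 - M) * (1 + M - T) = (1 - T) - (M * M - T * M) := by
  have h : (1 - M) * (1 + M - T) = (1 - T) - (M * M - M * T) := by noncomm_ring
  rw [h, ← hT]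

/-- `(1 + M - T)(1 - M) = (1 - T) - (M² - TM)` (no commutation needed). -/
theorem soloBlind_quad_factor_right (M T : R) :
    (1 + M - T) * (1 - M) = (1 - T) - (M * M - T * M) := by
  noncomm_ring

/-- If `E = (1 - T) - (M² - T M)` has a two-sided inverse `e` and `T` commutes with `M`, then
`1 - M` has the right inverse `(1 + M - T) e` and the left inverse `e (1 + M - T)`. -/
theorem soloBlind_resolvent_of_quadratic (M T e : R) (hT : T * M = M * T)
    (h1 : ((1 - T) - (M * M - T * M)) * e = 1) (h2 : e * ((1 - T) - (M * M - T * M)) = 1) :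
    (1 - M) * ((1 + M - T) * e) = 1 ∧ (e * (1 + M - T)) * (1 - M) = 1 := by
  constructor
  · rw [← mul_assoc, soloBlind_quad_factor_left M T hT, h1]
  · rw [mul_assoc, soloBlind_quad_factor_right M T, h2]

/-- The two one-sided inverses of `1 - M` coincide (so `1 - M` is a unit). -/
theorem soloBlind_resolvent_of_quadratic_two_sided (M T e : R) (hT : T * M = M * T)
    (h1 : ((1 - T) - (M * M - T * M)) * e = 1) (h2 : e * ((1 - T) - (M * M - T * M)) = 1) :
    (1 + M - T) * e = e * (1 + M - T) := by
  obtain ⟨hr, hl⟩ := soloBlind_resolvent_of_quadratic M T e hT h1 h2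
  exact (left_inv_eq_right_inv hl hr).symm

/-- `1 - M` is a unit under the hypotheses of `soloBlind_resolvent_of_quadratic`. -/
theorem soloBlind_isUnit_one_sub_of_quadratic (M T e : R) (hT : T * M = M * T)
    (h1 : ((1 - T) - (M * M - T * M)) * e = 1) (h2 : e * ((1 - T) - (M * M - T * M)) = 1) :
    IsUnit (1 - M) := by
  obtain ⟨hr, hl⟩ := soloBlind_resolvent_of_quadratic M T e hT h1 h2
  have heq := soloBlind_resolvent_of_quadratic_two_sided M T e hT h1 h2
  refine ⟨⟨1 - M, (1 + M - T) * e, hr, ?_⟩, rfl⟩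
  rw [heq]; exact hl

end ring

section normed

variable {R : Type*} [NormedRing R] [NormOneClass R]

/-- Norm form of the resolvent transfer: `‖(1 + M - T) e‖ ≤ (1 + ‖M‖ + ‖T‖) ‖e‖`. -/
theorem soloBlind_resolvent_norm_le (M T e : R) :
    ‖(1 + M - T) * e‖ ≤ (1 + ‖M‖ + ‖T‖) * ‖e‖ := by
  calc ‖(1 + M - T) * e‖ ≤ ‖1 + M - T‖ * ‖e‖ := norm_mul_le _ _
    _ ≤ (1 + ‖M‖ + ‖T‖) * ‖e‖ := by
        gcongr
        calc ‖1 + M - T‖ ≤ ‖1 + M‖ + ‖T‖ := norm_sub_le _ _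
          _ ≤ ‖(1 : R)‖ + ‖M‖ + ‖T‖ := by gcongr; exact norm_add_le _ _
          _ = 1 + ‖M‖ + ‖T‖ := by rw [norm_one]

end normed

section matrix

variable {𝕜 : Type*} [CommRing 𝕜] {n : Type*} [Fintype n]

/-- Spectral mapping for the quadratic `z(z - t)` on an eigenvector. -/
theorem soloBlind_quad_eigen (M : Matrix n n 𝕜) (v : n → 𝕜) (μ t : 𝕜)
    (h : M.mulVec v = μ • v) :
    (M * M - t • M).mulVec v = (μ * (μ - t)) • v := by
  rw [Matrix.sub_mulVec, ← Matrix.mulVec_mulVec, h, Matrix.mulVec_smul, h,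
    Matrix.smul_mulVec, h, smul_smul, smul_smul, ← sub_smul]
  congr 1; ring

end matrix

end Summit.AnomalousDissipation.AnomalousDissipation.Theorems
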